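import Literature.Topology.FourManifolds.CircleSurgerySimplyConnected
import Literature.Topology.FourManifolds.InfiniteCyclicCover
import Literature.Topology.FourManifolds.CircleMapWindingHomotopy
import Literature.Topology.FourManifolds.CircleLoopNullhomotopy
import Literature.Topology.FourManifolds.TorusCoordinates
import Literature.Topology.FourManifolds.CircleDiffeotopy
import Literature.AlgebraicTopology.FundamentalGroup.VanKampenPushout
import Literature.AlgebraicTopology.FundamentalGroup.SphereCoreComplementPi1
import Literature.AlgebraicTopology.FundamentalGroup.SphereSimplyConnected
import Mathlib.Data.ZMod.Basic
import HarnessLib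

/-!
# The class of a loop of `S¹ × S³` killed by a circle surgery: `Φ ∘ ℓ ≃` fibre or its reverse

Topic `Literature/Topology/FourManifolds`.  Input of the reduction of
`Literature.Topology.FourManifolds.msz_loopSurgery_homotopySphere_gk` (Meier–Schirmer–Zupan 2016,
Thm. 1.2, read on loop presentations of homotopy 4-spheres) to the classification
`msz_trisection_classification_gk`: once the loop partner `X` of a homotopy 4-sphere `M = X_ℓ`
is a copy of `S¹ × S³`, simple connectivity of `M` forces the loop `ℓ` to run ONCE around the
`S¹`-factor — "`π₁(M) = π₁(X)/⟨⟨[ℓ]⟩⟩` (Kosinski 1993, X Lemma 1.2) is trivial, so `[ℓ]` normally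
generates `π₁(S¹ × S³) = ℤ`, i.e. `[ℓ] = ±1`" (docstring of the fact) — and a loop of
`S¹ × S³` of degree `±1` is homotopic to the fibre circle or to its reverse.

## Main results (everything proved; no definitions, no named facts)

* `CircleMaps.homotopic_id_zpow_degree` — **a circle
  map `G : S¹ → S¹` is homotopic to `z ↦ z ^ deg G`** (Hatcher 2002, Thm. 1.7; from the tree's
  torus classification `CircleMaps.homotopic_monomial_of_degree`); `CircleMaps.winding_eq_degree_mul`
  — `winding G σ = deg G · winding id σ`; `CircleMaps.winding_circleLoop_dvd` — for a circle-valued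
  map `g` on the round circle `𝕊¹ ⊆ ℝ²`, the winding number of `g` along the standard loop divides
  its winding number along every loop.
* `homotopic_fibre_or_conj_of_winding` — **a map `f : 𝕊¹ → 𝕊¹ × 𝕊³` whose first component
  has winding number `±1` along the standard loop is homotopic to the fibre circle `u ↦ (u, q)` or
  to its reverse `u ↦ (ū, q)`** (`S³` is simply connected, Hatcher Prop. 1.14; circle maps are
  classified by the degree, Thm. 1.7).
* `winding_circleLoop_eq_one_or_neg_one_of_isCircleSurgery` — **if `M` is obtained from a path
  connected `X` by surgery on the loop `ℓ` (`IsCircleSurgery`, either framing) and `M` is simply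
  connected, then for every circle-valued `F : X → S¹` admitting a loop of winding number one,
  `winding F ℓ = ±1`.**  Proof (Seifert–van Kampen, Hatcher Thm. 1.20, the tree's pushout form
  `VanKampen.existsUnique_hom_of_cover`, for `M = jA(X ∖ ℓ) ∪ jB(D̊² × S²)`): with
  `d = winding F ℓ`, the homomorphism `π₁(jA(X ∖ ℓ)) → π₁(X) → ℤ → ℤ/d` (winding numbers of
  `F`) and the trivial homomorphism on `π₁(jB(D̊² × S²))` agree on the overlap — a loop in the
  punctured tube `ν(S¹ × (B³ ∖ 0))` is homotopic through `ν(u, s w)` to a loop on `ℓ`, whose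
  `F`-winding number is a multiple of `d` — so they extend to `π₁(M) = 1`; but the first one is onto
  (`π₁(X ∖ ℓ) → π₁(X)` is onto, Kosinski X.2 / the tree's `VanKampen.bijective_inclHom_compl_core`,
  and `F` has a loop of winding number one), whence `ℤ/d = 0`, `d = ±1`.

## References

* A. Kosinski, *Differential Manifolds* (1993), Ch. X §1 Lemma (1.2), §2 proof of Thm. (2.2).
  [Kosinski1993]
* A. Hatcher, *Algebraic Topology* (2002), Thm. 1.7, Prop. 1.14, Lemma 1.15, Thm. 1.20.
  [HatcherAT2002]
* J. Meier, T. Schirmer, A. Zupan, Proc. AMS 144 (2016), arXiv:1507.06561, Thm. 1.2 and its use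
  for loop presentations (docstring of `msz_loopSurgery_homotopySphere_gk`). [MeierSchirmerZupan2016]
-/

noncomputable section

open scoped Manifold ContDiff Topology unitInterval
open Set Function Metric
open Literature.AlgebraicTopology.FundamentalGroup
open Literature.AlgebraicTopology.FundamentalGroup.VanKampen

namespace Literature.Topology.FourManifolds

/-! ### Circle maps: homotopy invariance in the map, classification by the degree -/

namespace CircleMaps

/-- **A circle map is homotopic to the power map of its degree**: `G ≃ (z ↦ z ^ deg G)`
(Hatcher 2002, §1.1 Thm. 1.7: `[S¹, S¹] = ℤ` via the degree).  From the tree's classification of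
torus maps (`homotopic_monomial_of_degree`) applied to `(z, u) ↦ G z`, restricted to `u = 1`.
[cite: HatcherAT2002, §1.1 Thm. 1.7] -/
theorem homotopic_id_zpow_degree (G : C(Circle, Circle)) :
    G.Homotopic ((ContinuousMap.id Circle) ^ degree G) := by
  set F : C(Circle × Circle, Circle) := G.comp fstC with hF
  have hFG : F.comp inclFst = G := by ext x; rfl
  have h₁ : degree (F.comp inclFst) = degree G := by rw [hFG]
  have h₂ : degree (F.comp inclSnd) = 0 := by
    have : F.comp inclSnd = ContinuousMap.const Circle (G 1) := by ext u; rfl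
    rw [this, degree_const]
  have hF' : F.Homotopic (monomial (degree G) 0) := homotopic_monomial_of_degree F h₁ h₂
  have hmono : (monomial (degree G) 0).comp inclFst = (ContinuousMap.id Circle) ^ degree G := by
    ext x
    simp [monomial, inclFst, fstC, sndC]
  have := hF'.comp (ContinuousMap.Homotopic.refl inclFst)
  rwa [hFG, hmono] at this

/-- **`winding G σ = deg G · winding id σ`** for every loop `σ` of the circle and every circle map
`G` (Hatcher 2002, Thm. 1.7). [cite: HatcherAT2002, §1.1 Thm. 1.7] -/
theorem winding_eq_degree_mul (G : C(Circle, Circle)) {z : Circle} (τ : Path z z) :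
    winding G τ = degree G * winding (ContinuousMap.id Circle) τ := by
  -- read both sides as winding numbers of `id` along mapped loops; homotopic maps give the same
  -- winding numbers (`winding_map_eq_of_homotopic`; cf. the landed
  -- `Literature.Geometry.Riemannian.winding_eq_of_homotopic_maps`, not imported here to keep
  -- this file's import cone topological)
  have h0 : winding G τ = winding (ContinuousMap.id Circle) (τ.map G.continuous) :=
    winding_congr _ _ _ _ fun _ => rfl
  have h1 : winding ((ContinuousMap.id Circle) ^ degree G) τ =
      winding (ContinuousMap.id Circle)
        (τ.map ((ContinuousMap.id Circle) ^ degree G).continuous) :=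
    winding_congr _ _ _ _ fun _ => rfl
  rw [h0, winding_map_eq_of_homotopic (ContinuousMap.id Circle) (homotopic_id_zpow_degree G) τ,
    ← h1, winding_zpow]

/-- `toCircle : 𝕊¹ → Circle` is continuous. [folklore] -/
private theorem continuous_toCircle_fibreClass : Continuous toCircle :=
  (contDiff_toC.continuous.comp continuous_subtype_val).subtype_mk _

/-- `toCircle : 𝕊¹ → Circle` is onto. [folklore] -/
private theorem toCircle_surjective_fibreClass : Surjective toCircle := fun z ↦ by
  refine ⟨circlePoint (Complex.arg (z : ℂ)), ?_⟩
  conv_rhs => rw [← Circle.exp_arg z]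
  apply Circle.ext
  rw [coe_toCircle, Circle.coe_exp]
  apply Complex.ext
  · rw [toC_re, circlePoint_apply_zero, Complex.exp_ofReal_mul_I_re]
  · rw [toC_im, circlePoint_apply_one, Complex.exp_ofReal_mul_I_im]

/-- **The round circle `𝕊¹ ⊆ ℝ²` is homeomorphic to the circle group along `toCircle`**
(`(x₀, x₁) ↦ x₀ + i x₁`, a continuous bijection from a compact space to a Hausdorff space).
[folklore] -/
theorem exists_homeomorph_toCircle :
    ∃ e : (Metric.sphere (0 : EuclideanSpace ℝ (Fin 2)) 1) ≃ₜ Circle, ∀ u, e u = toCircle u :=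
  ⟨Continuous.homeoOfEquivCompactToT2
    (f := Equiv.ofBijective toCircle ⟨toCircle_injective, toCircle_surjective_fibreClass⟩)
    continuous_toCircle_fibreClass, fun _ => rfl⟩

/-- `toCircle` carries the standard parametrisation of `𝕊¹` to the standard loop of `Circle`:
`toCircle (cos 2πt, sin 2πt) = e^{2πit}`. [folklore] -/
theorem toCircle_circleParam (t : I) : toCircle (circleParam t) = stdLoop t :=
  Circle.ext (toC_circlePt t)

/-- **On the round circle, the winding number of a circle-valued map along the standard loop
divides its winding number along every loop** (read through `toCircle`: both are multiples of the
degree, `winding_eq_degree_mul`, and the standard loop has `winding id = 1`).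
[cite: HatcherAT2002, §1.1 Thm. 1.7] -/
theorem winding_circleLoop_dvd (g : C(Metric.sphere (0 : EuclideanSpace ℝ (Fin 2)) 1, Circle))
    {u : Metric.sphere (0 : EuclideanSpace ℝ (Fin 2)) 1} (ρ : Path u u) :
    winding g (ContinuousMap.id _).circleLoop ∣ winding g ρ := by
  obtain ⟨e, he⟩ := exists_homeomorph_toCircle
  let eC' : C(Circle, Metric.sphere (0 : EuclideanSpace ℝ (Fin 2)) 1) := ⟨e.symm, e.symm.continuous⟩
  set G : C(Circle, Circle) := g.comp eC' with hG
  have hg : ∀ {v} (τ : Path v v),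
      winding g τ = degree G * winding (ContinuousMap.id Circle) (τ.map e.continuous) := by
    intro v τ
    have : winding g τ = winding G (τ.map e.continuous) :=
      winding_congr _ _ _ _ fun t => by
        rw [hG]
        simp only [eC', ContinuousMap.comp_apply, ContinuousMap.coe_mk, Path.map_coe,
          Function.comp_apply, Homeomorph.symm_apply_apply]
    rw [this, winding_eq_degree_mul]
  have h1 : winding (ContinuousMap.id Circle)
      (((ContinuousMap.id _).circleLoop).map e.continuous) = 1 := by
    have : winding (ContinuousMap.id Circle) (((ContinuousMap.id _).circleLoop).map e.continuous) =
        winding (ContinuousMap.id Circle) stdLoop :=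
      winding_congr _ _ _ _ fun t => by
        show e (circleParam t) = stdLoop t
        rw [he, toCircle_circleParam]
    rw [this]
    exact degree_id
  rw [hg ρ, hg, h1, mul_one]
  exact Dvd.intro _ rfl

end CircleMaps

/-! ### A loop of `S¹ × S³` of degree `±1` is the fibre circle or its reverse -/

section FibreClass

open CircleMaps

/-- `toCircle ∘ conj = (toCircle ·)⁻¹`: complex conjugation of the round circle is inversion
in the circle group. [folklore] -/
theorem toCircle_circleConj (u : Metric.sphere (0 : EuclideanSpace ℝ (Fin 2)) 1) :
    toCircle (circleConj u) = (toCircle u)⁻¹ := by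
  apply Circle.ext
  rw [Circle.coe_inv_eq_conj, coe_toCircle, coe_toCircle]
  apply Complex.ext
  · simp [toC_re, coe_circleConj_apply]
  · simp [toC_im, coe_circleConj_apply]

/-- **A map `f : 𝕊¹ → 𝕊¹ × 𝕊³` whose first component has winding number `±1` along the
standard loop is homotopic to the fibre circle `u ↦ (u, q)` or to its reverse `u ↦ (ū, q)`.**
The second component is null-homotopic (`π₁(S³) = 1`, Hatcher Prop. 1.14, and
`ContinuousMap.homotopic_of_circleLoop_homotopic_refl`); the first, read in the circle group, is
homotopic to `z ↦ z^{±1}` (`CircleMaps.homotopic_id_zpow_degree`), i.e. to the identity or to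
complex conjugation (`toCircle_circleConj`).  The circle-valued map `T` is `toCircle`
(`(x₀, x₁) ↦ x₀ + i x₁`), any continuous-map packaging of it.
[cite: HatcherAT2002, §1.1 Thm. 1.7 and Prop. 1.14] -/
theorem homotopic_fibre_or_conj_of_winding
    (f : C(Metric.sphere (0 : EuclideanSpace ℝ (Fin 2)) 1,
      (Metric.sphere (0 : EuclideanSpace ℝ (Fin 2)) 1) × (Metric.sphere (0 : EuclideanSpace ℝ (Fin 4)) 1)))
    (q : Metric.sphere (0 : EuclideanSpace ℝ (Fin 4)) 1)
    (T : C(Metric.sphere (0 : EuclideanSpace ℝ (Fin 2)) 1, Circle)) (hT : ∀ u, T u = toCircle u)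
    (hd : winding T ((⟨Prod.fst, continuous_fst⟩ : C(_, _)).comp f).circleLoop = 1 ∨
      winding T ((⟨Prod.fst, continuous_fst⟩ : C(_, _)).comp f).circleLoop = -1) :
    f.Homotopic ((ContinuousMap.id _).prodMk (ContinuousMap.const _ q)) ∨
      f.Homotopic ((⟨⇑circleConj, circleConj.continuous⟩ : C(_, _)).prodMk
        (ContinuousMap.const _ q)) := by
  set g : C(_, Metric.sphere (0 : EuclideanSpace ℝ (Fin 2)) 1) :=
    (⟨Prod.fst, continuous_fst⟩ : C(_, _)).comp f with hgdef
  set h : C(_, Metric.sphere (0 : EuclideanSpace ℝ (Fin 4)) 1) :=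
    (⟨Prod.snd, continuous_snd⟩ : C(_, _)).comp f with hhdef
  have hf : f = g.prodMk h := by
    ext u : 1
    rfl
  -- the second component is null-homotopic
  haveI : SimplyConnectedSpace (Metric.sphere (0 : EuclideanSpace ℝ (Fin 4)) 1) :=
    simplyConnectedSpace_euclideanSphere (n := 3) (hn := by norm_num)
  have hh : h.Homotopic (ContinuousMap.const _ q) :=
    ContinuousMap.homotopic_of_circleLoop_homotopic_refl h (ContinuousMap.const _ q)
      (SimplyConnectedSpace.paths_homotopic _ _) (SimplyConnectedSpace.paths_homotopic _ _)
  -- the first component, read in the circle group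
  obtain ⟨e, he⟩ := exists_homeomorph_toCircle
  let eC : C(Metric.sphere (0 : EuclideanSpace ℝ (Fin 2)) 1, Circle) := ⟨e, e.continuous⟩
  let eC' : C(Circle, Metric.sphere (0 : EuclideanSpace ℝ (Fin 2)) 1) := ⟨e.symm, e.symm.continuous⟩
  have hTe : T = eC := by
    ext u : 1
    simp only [eC, ContinuousMap.coe_mk]
    rw [hT, ← he]
  set G : C(Circle, Circle) := (T.comp g).comp eC' with hGdef
  -- its degree is `winding T (g.circleLoop) = ±1`
  have hdeg : degree G = winding T g.circleLoop := by
    have h1 : winding T g.circleLoop = winding (T.comp g) (ContinuousMap.id _).circleLoop :=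
      winding_congr _ _ _ _ fun t => rfl
    have h2 : winding (T.comp g) (ContinuousMap.id _).circleLoop =
        winding G (((ContinuousMap.id _).circleLoop).map e.continuous) :=
      winding_congr _ _ _ _ fun t => by
        rw [hGdef]
        simp only [eC', ContinuousMap.comp_apply, ContinuousMap.coe_mk, Path.map_coe,
          Function.comp_apply, Homeomorph.symm_apply_apply]
    have h3 : winding (ContinuousMap.id Circle)
        (((ContinuousMap.id _).circleLoop).map e.continuous) = 1 := by
      have : winding (ContinuousMap.id Circle)
          (((ContinuousMap.id _).circleLoop).map e.continuous) =
          winding (ContinuousMap.id Circle) stdLoop :=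
        winding_congr _ _ _ _ fun t => by
          show e (circleParam t) = stdLoop t
          rw [he, toCircle_circleParam]
      rw [this]
      exact degree_id
    rw [h1, h2, winding_eq_degree_mul, h3, mul_one]
  have hG : G.Homotopic ((ContinuousMap.id Circle) ^ degree G) := homotopic_id_zpow_degree G
  -- back on the round circle: `g = e⁻¹ ∘ G ∘ e`
  have hgG : g = eC'.comp (G.comp eC) := by
    ext u : 1
    rw [hGdef, hTe]
    simp [eC, eC']
  have key : ∀ n : ℤ, degree G = n →
      g.Homotopic (eC'.comp ((((ContinuousMap.id Circle) ^ n)).comp eC)) := by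
    rintro n rfl
    rw [hgG]
    exact (ContinuousMap.Homotopic.refl _).comp (hG.comp (ContinuousMap.Homotopic.refl _))
  rcases hd with hd | hd
  · left
    have h1 := key 1 (hdeg.trans hd)
    have hid : eC'.comp ((((ContinuousMap.id Circle) ^ (1 : ℤ))).comp eC) = ContinuousMap.id _ := by
      ext u : 1
      show e.symm (((ContinuousMap.id Circle) ^ (1 : ℤ)) (e u)) = u
      rw [zpow_one, ContinuousMap.id_apply, e.symm_apply_apply]
    rw [hid] at h1
    rw [hf]
    exact h1.prodMk hh
  · right
    have h1 := key (-1) (hdeg.trans hd)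
    have hconj : eC'.comp ((((ContinuousMap.id Circle) ^ (-1 : ℤ))).comp eC) =
          (⟨⇑circleConj, circleConj.continuous⟩ : C(_, _)) := by
      ext u : 1
      show e.symm (((ContinuousMap.id Circle) ^ (-1 : ℤ)) (e u)) = circleConj u
      rw [Homeomorph.symm_apply_eq, zpow_neg, zpow_one, ContinuousMap.inv_apply,
        ContinuousMap.id_apply, he, he, toCircle_circleConj]
    rw [hconj] at h1
    rw [hf]
    exact h1.prodMk hh

end FibreClass

/-! ### The degree of a loop killed by a circle surgery with simply connected result is `±1` -/

section Surgery

open CircleMaps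

variable {X : Type} [TopologicalSpace X] [T2Space X] [ChartedSpace (EuclideanSpace ℝ (Fin 4)) X]
  {c : (Metric.sphere (0 : EuclideanSpace ℝ (Fin (1 + 1))) 1) → X}

/-- The complement `X ∖ c` of a circle with a tube in a path connected Hausdorff `X` is path
connected (reroute paths through the punctured tube `ν(S¹ × (ℝ³ ∖ 0))`, which is path connected;
the tree's `VanKampen.isPathConnected_compl_of_nbhd`). [cite: Kosinski1993, Ch. X §2, Thm. 2.2 (proof)] -/
theorem CircleNbhd.pathConnectedSpace_complement [PathConnectedSpace X] (ν : CircleNbhd (𝓡 4) c) :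
    PathConnectedSpace ↥ν.complement := by
  have hrank2 : 1 < Module.rank ℝ (EuclideanSpace ℝ (Fin (1 + 1))) := by
    rw [← Module.finrank_eq_rank, finrank_euclideanSpace_fin]; norm_num
  have hrank3 : 1 < Module.rank ℝ (EuclideanSpace ℝ (Fin 3)) := by
    rw [← Module.finrank_eq_rank, finrank_euclideanSpace_fin]; norm_num
  have hS : IsClosed (range c) := ν.isClosed_range_curve
  have hST : range c ⊆ range ν.toFun := by
    rintro _ ⟨u, rfl⟩
    exact ⟨(u, 0), ν.apply_zero u⟩
  have hTS : range ν.toFun \ range c = ν.toFun '' {q | q.2 ≠ 0} := by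
    ext x
    constructor
    · rintro ⟨⟨q, rfl⟩, hx⟩
      refine ⟨q, fun hq => hx ?_, rfl⟩
      obtain ⟨u, w⟩ := q
      simp only at hq
      subst hq
      exact ⟨u, (ν.apply_zero u).symm⟩
    · rintro ⟨⟨u, w⟩, hq, rfl⟩
      exact ⟨⟨(u, w), rfl⟩, fun hmem => hq ((ν.apply_mem_range_iff).1 hmem)⟩
  have hpc : IsPathConnected (range ν.toFun \ range c) := by
    rw [hTS]
    have hset : {q : (Metric.sphere (0 : EuclideanSpace ℝ (Fin (1 + 1))) 1) ×
        EuclideanSpace ℝ (Fin 3) | q.2 ≠ 0} = univ ×ˢ ({0}ᶜ : Set (EuclideanSpace ℝ (Fin 3))) := by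
      ext q; simp
    rw [hset]
    haveI : PathConnectedSpace (Metric.sphere (0 : EuclideanSpace ℝ (Fin (1 + 1))) 1) :=
      isPathConnected_iff_pathConnectedSpace.1 (isPathConnected_sphere hrank2 0 zero_le_one)
    exact (isPathConnected_univ.prod
      (isPathConnected_compl_singleton_of_one_lt_rank hrank3 0)).image ν.continuous
  have h := isPathConnected_compl_of_nbhd hS ν.isOpen_range hST isPathConnected_univ hpc
  exact isPathConnected_iff_pathConnectedSpace.1 h

/-- Bijectivity of `i_* : π₁(S) → π₁(Y)` is invariant under rewriting the subset. [folklore] -/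
private theorem surjective_inclHom_congr_set {Y : Type*} [TopologicalSpace Y] {S T : Set Y}
    (e : S = T) {x : Y} (hS : x ∈ S) (hT : x ∈ T) :
    Function.Surjective (inclHom S x hS) ↔ Function.Surjective (inclHom T x hT) := by
  subst e
  exact Iff.rfl

/-- **`π₁(X ∖ c) → π₁(X)` is onto** at a point of the punctured tube (Kosinski 1993, X.2, proof of
Thm. (2.2): the normal fibre `ℝ³` of the circle has simply connected puncture; the tree's
`VanKampen.bijective_inclHom_compl_core` for the open embedding `ν : S¹ × ℝ³ → X`).
[cite: Kosinski1993, Ch. X §2, Thm. 2.2 (proof)] -/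
theorem CircleNbhd.surjective_inclHom_complement [PathConnectedSpace X] (ν : CircleNbhd (𝓡 4) c)
    {q₀ : (Metric.sphere (0 : EuclideanSpace ℝ (Fin (1 + 1))) 1) × EuclideanSpace ℝ (Fin 3)}
    (hq₀ : q₀.2 ≠ 0) (hmem : ν.toFun q₀ ∈ (ν.complement : Set X)) :
    Function.Surjective (inclHom (ν.complement : Set X) (ν.toFun q₀) hmem) := by
  have hrank2 : 1 < Module.rank ℝ (EuclideanSpace ℝ (Fin (1 + 1))) := by
    rw [← Module.finrank_eq_rank, finrank_euclideanSpace_fin]; norm_num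
  haveI : PathConnectedSpace (Metric.sphere (0 : EuclideanSpace ℝ (Fin (1 + 1))) 1) :=
    isPathConnected_iff_pathConnectedSpace.1 (isPathConnected_sphere hrank2 0 zero_le_one)
  haveI : SimplyConnectedSpace ↥(({0} : Set (EuclideanSpace ℝ (Fin 3)))ᶜ) :=
    Literature.AlgebraicTopology.FundamentalGroupoid.isSimplyConnected_compl_singleton_of_isOpenEmbedding
      (M := EuclideanSpace ℝ (Fin 3)) (i := id) Topology.IsOpenEmbedding.id
      (by rw [finrank_euclideanSpace, Fintype.card_fin]; omega)
  have h := bijective_inclHom_compl_core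
    (Z := (Metric.sphere (0 : EuclideanSpace ℝ (Fin (1 + 1))) 1)) (E := EuclideanSpace ℝ (Fin 3))
    (W := X) (φ := ν.toFun) ν.isOpenEmbedding (q₀ := q₀) hq₀
  have hset : (ν.toFun '' (univ ×ˢ ({0} : Set (EuclideanSpace ℝ (Fin 3)))))ᶜ =
      (ν.complement : Set X) := by
    rw [ν.image_zeroSection]; rfl
  exact (surjective_inclHom_congr_set hset _ hmem).1 h.2

/-- The fundamental group of a simply connected space is trivial (at every point). [folklore] -/
private theorem fundamentalGroup_eq_one_of_simplyConnected {M : Type*} [TopologicalSpace M]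
    [SimplyConnectedSpace M] {p : M} (g : FundamentalGroup M p) : g = 1 :=
  haveI : Subsingleton (FundamentalGroup M p) :=
    inferInstanceAs (Subsingleton (Path.Homotopic.Quotient p p))
  Subsingleton.elim g 1

/-- **The degree of a loop killed by a circle surgery with simply connected result is `±1`.**
Let `X` be a path connected Hausdorff space (charted on `ℝ⁴`), `F : X → S¹` a circle-valued map
with some loop of winding number one, `ℓ` a loop of `X` with a tube, and `M` simply connected,
obtained from `X` by surgery on `ℓ` (`IsCircleSurgery`, either framing).  Then
`winding F ℓ = ±1`.  Seifert–van Kampen (Hatcher Thm. 1.20, pushout form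
`VanKampen.existsUnique_hom_of_cover`) for `M = jA(X ∖ ℓ) ∪ jB(D̊² × S²)`: with `d = winding F ℓ`,
the winding homomorphism of `F` on `π₁(jA(X ∖ ℓ))` reduced mod `d` and the trivial homomorphism
on `π₁(jB(D̊² × S²))` are compatible — a loop of the overlap lies in the punctured tube and is
homotopic, through `ν(u, s w)`, to a loop on `ℓ`, whose winding number is a multiple of `d`
(`CircleMaps.winding_circleLoop_dvd`) — so they factor through `π₁(M) = 1`; the first is onto
`ℤ/d` (`π₁(X ∖ ℓ) → π₁(X)` is onto, `CircleNbhd.surjective_inclHom_complement`; a loop of winding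
number one), hence `ℤ/d = 0` and `d = ±1`.  This is "`π₁(X_ℓ) = π₁(X)/⟨⟨[ℓ]⟩⟩` is trivial, so
`[ℓ]` normally generates" of Kosinski X Lemma 1.2, read through `F_* : π₁(X) → ℤ`.
[cite: Kosinski1993, Ch. X §1, Lemma 1.2] [cite: HatcherAT2002, Thm. 1.20] -/
theorem winding_circleLoop_eq_one_or_neg_one_of_isCircleSurgery [PathConnectedSpace X]
    (F : C(X, Circle)) (hF : ∃ (x : X) (γ : Path x x), winding F γ = 1)
    (ℓ : C(Metric.sphere (0 : EuclideanSpace ℝ (Fin 2)) 1, X)) {M : Type} [TopologicalSpace M]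
    [SimplyConnectedSpace M] [ChartedSpace (EuclideanSpace ℝ (Fin 4)) M]
    (h : IsCircleSurgery (𝓡 4) (𝓡 4) X M ⇑ℓ) :
    winding F ℓ.circleLoop = 1 ∨ winding F ℓ.circleLoop = -1 := by
  obtain ⟨ν, jA, jB, hA, hAo, hB, hBo, hU, hR⟩ := h
  have hAe : Topology.IsOpenEmbedding jA := ⟨hA.isEmbedding, hAo⟩
  have hBe : Topology.IsOpenEmbedding jB := ⟨hB.isEmbedding, hBo⟩
  -- the degree `d` and the target group `ℤ/d`
  set d : ℤ := winding F ℓ.circleLoop with hd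
  set n : ℕ := d.natAbs with hn
  -- base points
  obtain ⟨a₀, b₀, h₀⟩ := ν.exists_basePoint
  obtain ⟨u₀, t₀, ht₀, hb₀, ha₀⟩ := h₀
  set p₀ : M := jA a₀ with hp₀
  have hxU : p₀ ∈ range jA := ⟨a₀, rfl⟩
  have hxT : p₀ ∈ range jB := ⟨b₀, ((hR a₀ b₀).2 ⟨u₀, t₀, ht₀, hb₀, ha₀⟩).symm⟩
  -- path-connectedness of the pieces
  haveI : PathConnectedSpace ↥ν.complement := ν.pathConnectedSpace_complement
  haveI : SimplyConnectedSpace ↥discTimesSphere := simplyConnectedSpace_discTimesSphere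
  have hUpc : IsPathConnected (range jA) := isPathConnected_range hAe.continuous
  have hTpc : IsPathConnected (range jB) := isPathConnected_range hBe.continuous
  have hmeet : IsPathConnected (range jA ∩ range jB) :=
    isPathConnected_range_inter_range_of_circleSurgeryRel hBe hR
  -- the first piece as a copy of `X ∖ ℓ` inside `X`
  let eU : ↥ν.complement ≃ₜ ↥(range jA) := hA.isEmbedding.toHomeomorph
  let ιU : C(↥(range jA), X) := ⟨fun p => ((eU.symm p : ↥ν.complement) : X), by fun_prop⟩
  have hιU : ∀ a : ↥ν.complement, ιU ⟨jA a, ⟨a, rfl⟩⟩ = (a : X) := fun a => by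
    show ((eU.symm (eU a) : ↥ν.complement) : X) = a
    rw [eU.symm_apply_apply]
  let FU : C(↥(range jA), Circle) := F.comp ιU
  -- the homomorphisms
  let cast : Multiplicative ℤ →* Multiplicative (ZMod n) :=
    AddMonoidHom.toMultiplicative (Int.castAddHom (ZMod n))
  let φU : FundamentalGroup ↥(range jA) ⟨p₀, hxU⟩ →* Multiplicative (ZMod n) :=
    cast.comp (windingHom FU ⟨p₀, hxU⟩)
  let φT : FundamentalGroup ↥(range jB) ⟨p₀, hxT⟩ →* Multiplicative (ZMod n) := 1
  -- (1) compatibility on the overlap: loops of the punctured tube have winding number in `dℤ`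
  have hν : ∀ {x₁ : X} (δ : Path x₁ x₁), (∀ t, δ t ∈ ν.toFun '' {q | q.2 ≠ 0}) →
      d ∣ winding F δ := by
    intro x₁ δ hδ
    -- lift `δ` through the open embedding `ν`
    have hδr : ∀ t, δ t ∈ range ν.toFun := fun t => by
      obtain ⟨q, -, hq⟩ := hδ t
      exact ⟨q, hq⟩
    set Tν := ν.toHomeo with hTν
    have hcont : Continuous fun t => Tν.symm (δ t) :=
      Tν.continuousOn_symm.comp_continuous δ.continuous fun t => by
        rw [hTν, CircleNbhd.toHomeo_target]; exact hδr t
    have hright : ∀ t, ν.toFun (Tν.symm (δ t)) = δ t := fun t => by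
      have := Tν.right_inv (by rw [hTν, CircleNbhd.toHomeo_target]; exact hδr t)
      simpa [hTν] using this
    let δ' : Path (Tν.symm x₁) (Tν.symm x₁) :=
      { toFun := fun t => Tν.symm (δ t)
        continuous_toFun := hcont
        source' := by simp
        target' := by simp }
    let νc : C(_, X) := ⟨ν.toFun, ν.continuous⟩
    let fstc : C((Metric.sphere (0 : EuclideanSpace ℝ (Fin (1 + 1))) 1) × EuclideanSpace ℝ (Fin 3),
        Metric.sphere (0 : EuclideanSpace ℝ (Fin (1 + 1))) 1) := ⟨Prod.fst, continuous_fst⟩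
    -- `ν ≃ ℓ ∘ fst` through `ν(u, (1 - s) w)`
    have hhom : νc.Homotopic (ℓ.comp fstc) :=
      ⟨{ toFun := fun p => ν.toFun (p.2.1, (1 - (p.1 : ℝ)) • p.2.2)
         continuous_toFun := ν.continuous.comp (by fun_prop)
         map_zero_left := fun q => by simp [νc]
         map_one_left := fun q => by
           show ν.toFun (q.1, (1 - (1 : ℝ)) • q.2) = ℓ q.1
           rw [sub_self, zero_smul, ν.apply_zero] }⟩
    have h1 : winding F δ = winding F (δ'.map νc.continuous) :=
      winding_congr _ _ _ _ fun t => by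
        show F (δ t) = F (ν.toFun (Tν.symm (δ t)))
        rw [hright]
    have h2 : winding F (δ'.map (ℓ.comp fstc).continuous) = winding (F.comp ℓ) (δ'.map fstc.continuous) :=
      winding_congr _ _ _ _ fun t => rfl
    rw [h1, winding_map_eq_of_homotopic F hhom δ', h2]
    have h3 : d = winding (F.comp ℓ) (ContinuousMap.id _).circleLoop :=
      winding_congr _ _ _ _ fun t => rfl
    rw [h3]
    exact winding_circleLoop_dvd (F.comp ℓ) _
  have compat : ∀ (δ : Path p₀ p₀) (hUδ : ∀ t, δ t ∈ range jA) (hTδ : ∀ t, δ t ∈ range jB),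
      φU (FundamentalGroup.fromPath (Path.Homotopic.Quotient.mk (liftPath (range jA) δ hUδ))) =
        φT (FundamentalGroup.fromPath (Path.Homotopic.Quotient.mk (liftPath (range jB) δ hTδ))) := by
    intro δ hUδ hTδ
    show cast (windingHom FU ⟨p₀, hxU⟩ _) = 1
    rw [windingHom_fromPath]
    show Multiplicative.ofAdd ((winding FU (liftPath (range jA) δ hUδ) : ℤ) : ZMod n) = 1
    rw [← ofAdd_zero]
    congr 1
    rw [ZMod.intCast_zmod_eq_zero_iff_dvd, hn, Int.natAbs_dvd]
    -- the loop pushed into `X` lies in the punctured tube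
    have hmem : ∀ t, ((liftPath (range jA) δ hUδ).map ιU.continuous) t ∈ ν.toFun '' {q | q.2 ≠ 0} := by
      intro t
      obtain ⟨a, ha⟩ := hUδ t
      obtain ⟨b, hb⟩ := hTδ t
      obtain ⟨u, s, hs, -, hab⟩ := (hR a b).1 (ha.trans hb.symm)
      refine ⟨(u, s • (b.1.2 : EuclideanSpace ℝ (Fin 3))), ?_, ?_⟩
      · exact smul_ne_zero hs.1.ne' (ne_zero_of_mem_unit_sphere _)
      · rw [← hab]
        show (a : X) = ιU ⟨δ t, hUδ t⟩
        have : (⟨δ t, hUδ t⟩ : ↥(range jA)) = ⟨jA a, ⟨a, rfl⟩⟩ := Subtype.ext ha.symm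
        rw [this, hιU]
    have := hν ((liftPath (range jA) δ hUδ).map ιU.continuous) hmem
    rwa [← winding_comp_eq_winding_map] at this
  -- (2) the first homomorphism is onto: a loop of winding number one inside `X ∖ ℓ`
  have hsurjU : Function.Surjective φU := by
    -- the base point of `X ∖ ℓ` as a point of the punctured tube
    have hq₀ : (t₀ • ((b₀ : (EuclideanSpace ℝ (Fin 2)) ×
        (Metric.sphere (0 : EuclideanSpace ℝ (Fin 3)) 1)).2 : EuclideanSpace ℝ (Fin 3))) ≠ 0 :=
      smul_ne_zero ht₀.1.ne' (ne_zero_of_mem_unit_sphere _)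
    have hmem₀ : ν.toFun (u₀, t₀ • ((b₀ : (EuclideanSpace ℝ (Fin 2)) ×
        (Metric.sphere (0 : EuclideanSpace ℝ (Fin 3)) 1)).2 : EuclideanSpace ℝ (Fin 3))) ∈
          (ν.complement : Set X) := by
      rw [← ha₀]; exact a₀.2
    have hsurjA := ν.surjective_inclHom_complement hq₀ hmem₀
    -- a loop of winding number one at the base point
    obtain ⟨x, γ, hγ⟩ := hF
    let τ : Path (a₀ : X) x := (PathConnectedSpace.somePath (a₀ : X) x)
    have hγ' : winding F (τ.trans (γ.trans τ.symm)) = 1 := by rw [winding_conj, hγ]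
    set γ₀ : Path (ν.toFun (u₀, t₀ • ((b₀ : (EuclideanSpace ℝ (Fin 2)) ×
        (Metric.sphere (0 : EuclideanSpace ℝ (Fin 3)) 1)).2 : EuclideanSpace ℝ (Fin 3))))
        (ν.toFun (u₀, t₀ • ((b₀ : (EuclideanSpace ℝ (Fin 2)) ×
        (Metric.sphere (0 : EuclideanSpace ℝ (Fin 3)) 1)).2 : EuclideanSpace ℝ (Fin 3)))) :=
      (τ.trans (γ.trans τ.symm)).cast ha₀.symm ha₀.symm with hγ₀
    have hγ₀w : winding F γ₀ = 1 := by
      rw [← hγ']; exact winding_congr _ _ _ _ fun t => rfl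
    -- lift its class to `X ∖ ℓ`
    obtain ⟨gA, hgA⟩ := hsurjA (FundamentalGroup.fromPath (Path.Homotopic.Quotient.mk γ₀))
    obtain ⟨δA, hδAq⟩ := Quotient.exists_rep (FundamentalGroup.toPath gA)
    have hgA' : inclHom _ _ hmem₀ (FundamentalGroup.fromPath (Path.Homotopic.Quotient.mk δA)) =
        FundamentalGroup.fromPath (Path.Homotopic.Quotient.mk γ₀) := by
      rw [← hgA]
      exact congrArg _ hδAq
    rw [inclHom_fromPath] at hgA'
    have hδA : winding F (δA.map continuous_subtype_val) = 1 := by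
      rw [← hγ₀w]
      exact winding_eq_of_homotopic F (Path.Homotopic.Quotient.eq.1 hgA')
    -- move it into the first piece of `M`
    have hbase : eU ⟨ν.toFun (u₀, t₀ • ((b₀ : (EuclideanSpace ℝ (Fin 2)) ×
        (Metric.sphere (0 : EuclideanSpace ℝ (Fin 3)) 1)).2 : EuclideanSpace ℝ (Fin 3))), hmem₀⟩ =
          ⟨p₀, hxU⟩ := by
      apply Subtype.ext
      show jA _ = jA a₀
      congr 1
      exact Subtype.ext ha₀.symm
    let δU : Path (⟨p₀, hxU⟩ : ↥(range jA)) ⟨p₀, hxU⟩ := (δA.map eU.continuous).cast hbase.symm hbase.symm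
    have hδU : winding FU δU = 1 := by
      rw [← hδA]
      refine winding_congr _ _ _ _ fun t => ?_
      show F (ιU (eU (δA t))) = F ((δA t : ↥ν.complement) : X)
      congr 1
      show ((eU.symm (eU (δA t)) : ↥ν.complement) : X) = _
      rw [eU.symm_apply_apply]
    have h1 : Function.Surjective (windingHom FU ⟨p₀, hxU⟩) :=
      windingHom_surjective_of_winding_eq_one FU δU hδU
    have h2 : Function.Surjective cast := fun k => by
      obtain ⟨m, hm⟩ := ZMod.intCast_surjective (Multiplicative.toAdd k)
      exact ⟨Multiplicative.ofAdd m, by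
        show Multiplicative.ofAdd ((m : ZMod n)) = k
        rw [hm, ofAdd_toAdd]⟩
    exact h2.comp h1
  -- (3) van Kampen: both homomorphisms factor through `π₁(M) = 1`
  obtain ⟨Φ, ⟨hΦU, -⟩, -⟩ := existsUnique_hom_of_cover hAo hBo hU hxU hxT hUpc hTpc hmeet φU φT compat
  have htriv : ∀ k : Multiplicative (ZMod n), k = 1 := fun k => by
    obtain ⟨g, rfl⟩ := hsurjU k
    rw [← hΦU, MonoidHom.comp_apply, fundamentalGroup_eq_one_of_simplyConnected (inclHom _ _ _ g),
      map_one]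
  have hsub : Subsingleton (ZMod n) := ⟨fun a b => by
    have ha := htriv (Multiplicative.ofAdd a)
    have hb := htriv (Multiplicative.ofAdd b)
    rw [← hb] at ha
    exact Multiplicative.ofAdd.injective ha⟩
  have hn1 : n = 1 := ZMod.subsingleton_iff.1 hsub
  rw [hn] at hn1
  omega

end Surgery

end Literature.Topology.FourManifolds

end
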